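import Summits.ABC.IUTFork.Thm311LinkGlue
import HarnessLib

/-!
# [IUTchIII] Theorem 3.11 (iii) AS TYPED — discharge for constructed link data (cone node IUTchIII:Thm3.11(iii))

Proof-only companion (D-0067 cone interior; seat abc-iut-c312-1, gen 3, the typer of Theorem 3.11) to the seat's
files D `Thm311LinkCompat` (the typing of [IUTchIII] Thm. 3.11 (iii), kurims May 2020 `paper:url-4b091feeb646`
pp. 156–159: `LinkData.PartIIIa/b/c/d`, `FullSituation.EvalCompatUpToInd`, `FullSituation.PartIII`), J
`Thm311LinkLattice` and L `Thm311LinkGlue` (the objects of (iii) CONSTRUCTED functorially: `LinkData.ofFunctors`,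
`ofFunctorsCore`, `ofGlue` over abc-iut-L6-t3's `LatticeGlue`, `ofGlueRadial`). It records, with fully-qualified
closing types, what the kernel already knows piecewise: Theorem 3.11 (iii) AS TYPED holds for EVERY full situation
whose link data satisfy the structural clauses (c), (d) — in particular for every functorially constructed link
datum — as soon as Theorem 3.11 (i)'s concluding compatibility (`Situation.MultiradialCompat`) holds:
(iii) (a), (b) are tautologies of the signature (D `partIIIa_holds`/`partIIIb_holds`: squares of FULL
poly-isomorphisms commute), (c), (d) are functoriality (J `ofFunctors_partIIIc/_partIIId`, L
`ofFunctorsCore_partIIIc/_partIIId`, `ofGlue_partIIIc_partIIId`, `ofGlueRadial_partIIIc_partIIId`), and the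
«up to (Ind1), (Ind2), (Ind3)» clause `EvalCompatUpToInd` follows from (i) (D
`evalCompatUpToInd_of_multiradialCompat`). HONEST FRAMING: this discharges the TYPED (iii); the author says its
assertions «follow immediately from the definitions» (Proof of Thm. 3.11, p. 159), and LANA Rem. 8.2.1 (p. 42) /
Scholze–Stix §2.2 say in prose that the full-poly-isomorphism compatibilities are contentless — the typing agrees
(`partIIIc_independent` in L shows (c) is not a tautology for NON-constructed data). Nothing here bears on the
disputed Step (xi) of Cor. 3.12. [claim: Mochizuki2012, status: disputed] [cite: LANA2026Report, Rem. 8.2.1 p. 42]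
-/

namespace Summit.ABC.IUTFork.Thm311.FullSituation

open CategoryTheory Literature.IUT.LogThetaLattice

variable {T : ThetaIndex}

/-- **Theorem 3.11 (iii) AS TYPED from (iii)(c), (iii)(d) and Theorem 3.11 (i).** For any full situation whose
link data satisfy the structural clauses (c), (d), the multiradial compatibility of (i) yields (iii) in full
((a), (b) automatic; the final «up to (Ind1), (Ind2), (Ind3)» clauses from (i)). [claim: Mochizuki2012, status: disputed] -/
theorem partIII_of_multiradialCompat (S : Summit.ABC.IUTFork.Thm311.FullSituation T)
    (hc : S.link.PartIIIc) (hd : S.link.PartIIId) (hI : S.MultiradialCompat) :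
    Summit.ABC.IUTFork.Thm311.FullSituation.PartIII S :=
  (S.partIII_iff_evalCompat_of_link hc hd).2 (S.evalCompatUpToInd_of_multiradialCompat hI)

/-- Conversely (iii) AS TYPED contains (c), (d) and the «up to indeterminacies» clause. [folklore] -/
theorem partIIIc_partIIId_evalCompat_of_partIII (S : Summit.ABC.IUTFork.Thm311.FullSituation T)
    (h : S.PartIII) : S.link.PartIIIc ∧ S.link.PartIIId ∧ S.EvalCompatUpToInd :=
  ⟨h.2.2.1, h.2.2.2.1, h.2.2.2.2⟩

/-- **(iii) for J's functorially constructed link data** (`FullSituation.ofFunctors`: Kummer isomorphism natural,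
permutation-symmetry poly-isomorphisms = images of the full poly-isomorphism of `D`-Hodge theaters, automorphisms
acting functorially), given (i). [claim: Mochizuki2012, status: disputed] -/
theorem partIII_ofFunctors (S₀ : LatticeSituation T) {F : StripFrame.{0}} (H : ℤ × ℤ → F.HT)
    (Dl : ℤ → F.DHT) (ξ : ∀ n m : ℤ, F.htToD.obj (H (n, m)) ≅ Dl n) (Ffr : F.HT ⥤ F.Fxm)
    (Fet : F.DHT ⥤ F.Fxm) (kum : Ffr ≅ F.htToD ⋙ Fet) (Fenv : F.DHT ⥤ F.Fxm) (nat : Fet ≅ Fenv)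
    {Rad : Type} [Category.{0} Rad] (FR : F.DHT ⥤ Rad) {Kap : Type} [Category.{0} Kap]
    (FM : F.DHT ⥤ Kap) (hI : S₀.MultiradialCompat) :
    Summit.ABC.IUTFork.Thm311.FullSituation.PartIII
      (Summit.ABC.IUTFork.Thm311.FullSituation.ofFunctors S₀ H Dl ξ Ffr Fet kum Fenv nat FR FM) :=
  partIII_of_multiradialCompat _ (LinkData.ofFunctors_partIIIc H Dl ξ Ffr Fet kum Fenv nat FR FM)
    (LinkData.ofFunctors_partIIId H Dl ξ Ffr Fet kum Fenv nat FR FM) hI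

/-- **(iii) for L's link data glued from abc-iut-L6-t3's §1–§2 interfaces** (`FullSituation.ofGlue`: an L6
log-theta-lattice diagram `Λ` with its bi-coric data, Prop. 2.1 (vi) natural isomorphism, radial and `∞κ` data
on the core of the `D`-Hodge-theater category), given (i). [claim: Mochizuki2012, status: disputed] -/
theorem partIII_ofGlue (S₀ : LatticeSituation T) {F : StripFrame.{0}} (G : LatticeGlue F)
    (Λ : LogThetaLatticeDiagram G.logData G.linkData) {Rad : Type} [Category.{0} Rad]
    (FR : Core F.DHT ⥤ Rad) {Kap : Type} [Category.{0} Kap] (FM : Core F.DHT ⥤ Kap)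
    (hI : S₀.MultiradialCompat) :
    Summit.ABC.IUTFork.Thm311.FullSituation.PartIII
      (Summit.ABC.IUTFork.Thm311.FullSituation.ofGlue S₀ G Λ FR FM) :=
  partIII_of_multiradialCompat _ (LinkData.ofGlue_partIIIc_partIIId G Λ FR FM).1
    (LinkData.ofGlue_partIIIc_partIIId G Λ FR FM).2 hI

/-- **(iii) for L's `ofGlueRadial`** (radial data := Cor. 2.3 (ii)'s functor on the core; only the `∞κ` data `FM`
of [IUTchII] Cor. 4.7 (iii) remain an argument), given (i). [claim: Mochizuki2012, status: disputed] -/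
theorem partIII_ofGlueRadial (S₀ : LatticeSituation T) {F : StripFrame.{0}} (G : LatticeGlue F)
    (Λ : LogThetaLatticeDiagram G.logData G.linkData) {Kap : Type} [Category.{0} Kap] (FM : Core F.DHT ⥤ Kap)
    (hI : S₀.MultiradialCompat) :
    Summit.ABC.IUTFork.Thm311.FullSituation.PartIII
      ({ S₀ with link := LinkData.ofGlueRadial G Λ FM } : Summit.ABC.IUTFork.Thm311.FullSituation T) :=
  partIII_of_multiradialCompat _ (LinkData.ofGlueRadial_partIIIc_partIIId G Λ FM).1
    (LinkData.ofGlueRadial_partIIIc_partIIId G Λ FM).2 hI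

end Summit.ABC.IUTFork.Thm311.FullSituation
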